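import Summits.BirchSwinnertonDyer.BirchSwinnertonDyer.Theorems.ErratumRoadFiveNonSurjCornerMuCore
import Summits.BirchSwinnertonDyer.Rank1Residual.X10.CoreTheoremAOddPrime
import Literature.NumberTheory.EllipticCurves.Kato2004.DivisibilityInputsMultiplicativeFine
import Literature.NumberTheory.EllipticCurves.Wuthrich2014.IntegralPAdicLFunctionMultiplicative
import Literature.NumberTheory.EllipticCurves.ModularCurvePeriodRatio
import HarnessLib

/-!
# Route `ErratumRoadFive` (rung K2), crux 6 `NonSurjCorner` (item stmt-BirchSwinnertonDyer-19065), the twin summand: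
# the KATO `μ`-TRANSFER WITHOUT BIG IMAGE AT A MULTIPLICATIVE ODD PRIME — `μ(ϖ·L_p) = 0 ⟹ μ(X(E/ℚ_∞)) = 0` for
# `E[p]` irreducible, `ρ̄` not onto, `p ∥ N` — and hence TwinMuAn ⟹ TwinMu at the corner's leaf twins
# (cell `bsd-stepL`, seat `bsd-stepL-corner-p1` g6; `--supports stmt-BirchSwinnertonDyer-19065`)

WHAT. Rung K6 (`SmallImageMuTransfer`, cells `bsd-smallim` ∕ `b2b-bsdres`) kernel-checked the `μ`-transfer at a
GOOD ORDINARY odd prime modulo Kato's zeta-element package F1 (`X10.mu_eq_zero_of_fine`, p480380): a unit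
coefficient of `L_p` ⟹ `G₁ ∉ (p)` ⟹ (Thm. 12.6 span + p. 280 image) a GENUINE `Λ`-adic Euler-system class
`s ∉ p𝐇¹` ⟹ (the core, `Λ/p` Kolyvagin system at one `E`-split tame prime) `Sel₀(ℚ_∞,E[p^∞])[p]` killed by `T^J`
⟹ `X₀/pX₀` finite ⟹ `length_(p) X₀ = 0` ⟹ ((14.9.3) fine quotient) `length_(p) X = 0` ⟹ `μ(X) = 0`. Nothing in
that chain uses the reduction type at `p` except the §17.13 package itself: the core's good-ordinary binders are
inert (`CoreAssembly.coreOdd_anyReduction_holds`, this seat, p486975), the fine Selmer group has the zero local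
condition at `p`, and the §17.13 package at `p ∥ N` is printed (Kato 12.4–12.6, 13.3, 14.9, 16.6 under §16.1,
17.11 via Wuthrich 2014 p. 391 ∕ Kobayashi 2006 Thm. 4.1, 17.13; typed by `bsd-2adic` as
`Kato2004.MultDivisibilityInputs`, and with the fine quotient ∕ span ∕ image clauses as the construction fact
`Kato2004.exists_multDivisibilityInputs_fine`, this seat). This file runs the chain at `p ∥ N`:

* §1 `MultMu.lengthAt_X_le_of_mult`, `MultMu.exists_isEulerSystemClass_not_mem_of_mult` — the two pieces of
  module algebra over a multiplicative package (ports of `Kato2004.lengthAt_X_le_lengthAt_fine` and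
  `Kato2004.exists_isEulerSystemClass_not_mem`, same proofs);
* §2 **`MultMu.mu_eq_zero_of_multFine`** — for a globally minimal `W/ℚ`, an ODD prime `p` of MULTIPLICATIVE
  reduction, `E[p]` irreducible, `ρ̄` NOT onto, a newform `f`, the period ratio `ϖ` (`ϖ·Ω_E = Ω⁺_f`) and the
  Mazur–Tate–Teitelbaum function `L` (`α = a_p = ±1`, `IsMultPAdicLFunctionOf`): ONE `p`-adic unit coefficient of
  the Néron-normalised `ϖ·L` forces `D.mu = 0` for every cyclotomic Selmer dual datum `D` — modulo TWO named facts: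
  `Kato2004.exists_multDivisibilityInputs_fine` (CONSTRUCTION fact, the F1 of this road) and
  `Wuthrich2014.corollary18_padicLFunction_mem_iwasawaAlgebra_multiplicative` (`ϖ·L ∈ Λ`); Kato (12.2.1) is the tree
  theorem `nonempty_iwasawaH1Data_holds`;
* the corner consumers (TwinMuAn ⟹ the twin's `MultDivisibilityAt`, and the glue variant with the ANALYTIC child
  `NonSurjCornerTwinMuAn` in place of TwinMu) live in `Theorems/ErratumRoadFiveNonSurjCornerBranchesAn.lean`
  (they import the route file); this module stays Theses-free and serves 19111's (Tw)@3 at `p = 3` as well.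

READING (for the planner, condition (c3) «one shape for μ»): with this file the corner's twin summand has EXACTLY
rung K6's shape — transfer KERNEL-CHECKED modulo a Kato construction fact (here `exists_multDivisibilityInputs_fine`,
there F1 `exists_divisibilityInputs_fineQuotient_zeta`), residual = ANALYTIC `μ = 0` (here `NonSurjCornerTwinMuAn`,
there `AnalyticMuZeroX9`), class-wide = Greenberg's Conj. 1.11 through the main conjecture, PER PAIR a finite exact
modular-symbol certificate.

HONEST FRAMING: theorems only (no definition, no named fact minted here, no `sorry`); CONDITIONAL on the displayed
named facts; nothing is asserted about any curve; nothing is booked; items 19065 ∕ 19111 do not close; BSD is not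
advanced; no census word moves (T7). PARTITION (D-0054): X11b@p≥5 (B9 ∕ N8) × T4′ corner twin summand | O2@3 × T4″
twin — types-the-object-of; closes none.

References: [Kato2004Asterisque] Thm. 12.4–12.6 (pp. 221–222), Ex. 13.3 (p. 225), §13.8, (14.9.3) (p. 240), §16.1,
Thm. 16.6 (p. 271), 17.5 (p. 274), Prop. 17.11 (p. 277), §17.13 (pp. 279–280); [Wuthrich2014] p. 391, Cor. 18 (p. 398);
[Kobayashi2006DocMath] Thm. 4.1; [GreenbergLNM1716] §1 Conj. 1.11, §2; [MazurRubin2004] Prop. 1.3.2, §4.4, §5.3;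
tree: `X10/CoreTheoremAOddPrime*.lean` (b2b x10), `Kato2004/DivisibilityInputs{,Fine,Mu,Multiplicative}.lean`,
`Theorems/ErratumRoadFiveNonSurjCornerMuCore.lean` (p486975), HOME/pub/bsd-smallim/koly/MU-TRANSFER-PROOF.md.
-/

set_option autoImplicit false
set_option linter.dupNamespace false

noncomputable section

open scoped Classical MatrixGroups ModularForm NumberField
open CongruenceSubgroup WeierstrassCurve Field IsDedekindDomain
open Literature.NumberTheory.GaloisRepresentations
open Literature.NumberTheory.GaloisCohomology
open Literature.NumberTheory.EllipticCurves Literature.NumberTheory.EllipticCurves.ModularForms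
open Literature.NumberTheory.EllipticCurves.Kato2004 Literature.NumberTheory.EllipticCurves.Kato2004.EulerSystemValues
open Literature.NumberTheory.EllipticCurves.Rank1Residual
open Summit.BirchSwinnertonDyer.BirchSwinnertonDyer.Rank1Residual

namespace Summit.BirchSwinnertonDyer.Rank1Residual.X11b.MultMu

open Module

/-! ### §1 Module algebra over a multiplicative package (ports of `DivisibilityInputsFine` / `DivisibilityInputs`) -/

section Algebra

variable {p : ℕ} [Fact p.Prime] {W : WeierstrassCurve ℚ} [W.IsElliptic] [W.IsGloballyMinimal]
  [ContinuousSMul ℤ_[p] (W.tateModule p)] [Module.Free ℤ_[p] (W.tateModule p)]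
  [Module.Finite ℤ_[p] (W.tateModule p)] {L : PowerSeries ℚ_[p]}
  {κ : ZpExtension ℚ p} {γ : absoluteGaloisGroup ℚ}
  {I : IwasawaH1Data W p κ γ} {D : W.SelmerDualData κ γ}

omit [W.IsGloballyMinimal] [Module.Free ℤ_[p] (W.tateModule p)] [Module.Finite ℤ_[p] (W.tateModule p)] in
/-- **(14.9.3)/(17.13.1) bookkeeping at a height-one prime `𝔭` for a MULTIPLICATIVE package**: if
`toX ∘ loc = 0`, `col(loc Z)` contains `s·G₁` with `s, G₁ ∉ 𝔭`, and `π : X → Y` is exact after `P → X`, then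
`length X_𝔭 ≤ length Y_𝔭` (port of `Kato2004.lengthAt_X_le_lengthAt_fine`: `(Λ/col(loc Z))_𝔭 = 0`,
`P/loc Z ↪ Λ/col(loc Z)` by `col` injective, `P/loc Z → X → Y` exact at `X`).
[cite: Kato2004Asterisque, (14.9.3) (p. 240), §17.13 (pp. 279–280) and Prop. 17.11 (p. 277)] -/
theorem lengthAt_X_le_of_mult (K : MultDivisibilityInputs W p L κ γ I D)
    (hloc0 : ∀ h : I.H, K.toX (K.loc h) = 0) {G₁ : IwasawaAlgebra p}
    (𝔭 : PrimeSpectrum (IwasawaAlgebra p)) (hG𝔭 : G₁ ∉ 𝔭.asIdeal)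
    (himg : ∃ s : IwasawaAlgebra p, s ∉ 𝔭.asIdeal ∧ s * G₁ ∈ Submodule.map (K.col ∘ₗ K.loc) K.Z)
    {Y : Type*} [AddCommGroup Y] [Module (IwasawaAlgebra p) Y]
    (π : D.X →ₗ[IwasawaAlgebra p] Y) (hπ : Function.Exact K.toX π) :
    lengthAt (IwasawaAlgebra p) D.X 𝔭 ≤ lengthAt (IwasawaAlgebra p) Y 𝔭 := by
  obtain ⟨s, hs, hsG⟩ := himg
  set LZ : Submodule (IwasawaAlgebra p) K.P := Submodule.map K.loc K.Z with hLZ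
  set M : Ideal (IwasawaAlgebra p) := Submodule.map K.col LZ with hM
  have hM_eq : Submodule.map (K.col ∘ₗ K.loc) K.Z = M := by
    rw [hM, hLZ, Submodule.map_comp]
  have hsGM : s * G₁ ∈ M := hM_eq ▸ hsG
  have hnot : ¬ M ≤ 𝔭.asIdeal := fun hle ↦ by
    rcases 𝔭.isPrime.mem_or_mem (hle hsGM) with h | h
    · exact hs h
    · exact hG𝔭 h
  have hΛM : lengthAt (IwasawaAlgebra p) (IwasawaAlgebra p ⧸ M) 𝔭 = 0 :=
    lengthAt_quotient_eq_zero_of_not_le hnot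
  have hPLZ : lengthAt (IwasawaAlgebra p) (K.P ⧸ LZ) 𝔭 = 0 := by
    refine le_antisymm ?_ bot_le
    rw [← hΛM]
    refine lengthAt_le_of_injective (Submodule.mapQ LZ M K.col fun y hy ↦ ⟨y, hy, rfl⟩) ?_ 𝔭
    rw [← LinearMap.ker_eq_bot, Submodule.ker_mapQ, hM,
      Submodule.comap_map_eq_of_injective K.col_injective, Submodule.mkQ_map_self]
  have hle : LZ ≤ LinearMap.ker K.toX := by
    rintro _ ⟨z, -, rfl⟩
    exact hloc0 z
  let f' : (K.P ⧸ LZ) →ₗ[IwasawaAlgebra p] D.X := LZ.liftQ K.toX hle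
  have hf' : Function.Exact f' π := by
    rw [LinearMap.exact_iff, Submodule.range_liftQ]
    exact LinearMap.exact_iff.mp hπ
  calc lengthAt (IwasawaAlgebra p) D.X 𝔭
      ≤ lengthAt (IwasawaAlgebra p) (K.P ⧸ LZ) 𝔭 + lengthAt (IwasawaAlgebra p) Y 𝔭 :=
        lengthAt_le_add_of_exact f' π hf' 𝔭
    _ = lengthAt (IwasawaAlgebra p) Y 𝔭 := by rw [hPLZ, zero_add]

omit [W.IsGloballyMinimal] in
/-- **§6 (i) with Thm. 12.6 for a MULTIPLICATIVE package: `G₁ ∉ (p)` and `s·G₁ ∈ col(loc Z)` with `s ∉ (p)`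
force some GENUINE `Λ`-adic Euler-system class in the span of `Z` outside `p𝐇¹`** (port of
`Kato2004.exists_isEulerSystemClass_not_mem`). [cite: Kato2004Asterisque, Thm. 12.6 (p. 222) and §17.13 (p. 280)] -/
theorem exists_isEulerSystemClass_not_mem_of_mult (K : MultDivisibilityInputs W p L κ γ I D)
    (hZ : K.Z ≤ Submodule.span (IwasawaAlgebra p) {s : I.H | IsEulerSystemClass W p κ γ I s})
    {G₁ : IwasawaAlgebra p} (hμ : G₁ ∉ IwasawaAlgebra.augIdealP p)
    (himg : ∃ s : IwasawaAlgebra p, s ∉ IwasawaAlgebra.augIdealP p ∧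
      s * G₁ ∈ Submodule.map (K.col ∘ₗ K.loc) K.Z) :
    ∃ s : I.H, IsEulerSystemClass W p κ γ I s ∧
      s ∉ IwasawaAlgebra.augIdealP p • (⊤ : Submodule (IwasawaAlgebra p) I.H) := by
  obtain ⟨s, hs, hsG⟩ := himg
  suffices hz : ∃ z ∈ K.Z, z ∉ IwasawaAlgebra.augIdealP p • (⊤ : Submodule (IwasawaAlgebra p) I.H) by
    obtain ⟨z, hz, hzp⟩ := hz
    obtain ⟨t, ht, htp⟩ := exists_mem_not_mem_of_le_span hZ hz hzp
    exact ⟨t, ht, htp⟩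
  by_contra hcon
  push Not at hcon
  have hZp : K.Z ≤ IwasawaAlgebra.augIdealP p • (⊤ : Submodule (IwasawaAlgebra p) I.H) :=
    fun z hz ↦ hcon z hz
  have hsub : Submodule.map (K.col ∘ₗ K.loc) K.Z ≤
      (IwasawaAlgebra.augIdealP p • ⊤ : Submodule (IwasawaAlgebra p) (IwasawaAlgebra p)) :=
    (Submodule.map_mono hZp).trans (by rw [Submodule.map_smul'']; exact Submodule.smul_mono le_rfl le_top)
  have htop : (IwasawaAlgebra.augIdealP p • ⊤ : Submodule (IwasawaAlgebra p) (IwasawaAlgebra p)) =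
      IwasawaAlgebra.augIdealP p := by
    rw [Ideal.smul_eq_mul, Ideal.mul_top]
  have hsG' : s * G₁ ∈ IwasawaAlgebra.augIdealP p := by rw [← htop]; exact hsub hsG
  rcases (IwasawaAlgebra.isPrime_augIdealP_holds p).mem_or_mem hsG' with h | h
  · exact hs h
  · exact hμ h

end Algebra

/-! ### §2 The `μ`-transfer at a multiplicative odd prime, without big image -/

/-- **KATO `μ`-TRANSFER AT A MULTIPLICATIVE PRIME, NO BIG IMAGE.** For a globally minimal elliptic `W/ℚ`, an
ODD prime `p` of MULTIPLICATIVE reduction with `E[p]` irreducible and `ρ̄_{E,p}` NOT onto, a newform `f`, the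
period ratio `ϖ` (`ϖ·Ω_E = Ω⁺_f`) and the Mazur–Tate–Teitelbaum function `L` (`α = a_p = ±1`): ONE `p`-adic unit
coefficient of the Néron-normalised function `ϖ·L` forces `μ(X(E/ℚ_∞)) = 0` for every cyclotomic Selmer dual datum.
Inputs: the §17.13 package at `p ∥ N` with fine quotient + span + image clauses (`hfine`, CONSTRUCTION fact),
Wuthrich 2014 Cor. 18 (`h18`: `ϖ·L ∈ Λ`); Kato (12.2.1) is the tree theorem `nonempty_iwasawaH1Data_holds`; kernel: `h18 ⟹ G₁ ∈ Λ`, certificate ⟹ `G₁ ∉ (p)`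
⟹ (image + span clauses) a GENUINE Euler-system class `∉ p𝐇¹` ⟹ the reduction-free core
`CoreAssembly.coreOdd_anyReduction_holds` ⟹ `Sel₀[p]` killed by `T^J` ⟹ `X₀/pX₀` finite ⟹ `length_(p) X₀ = 0` ⟹
(complex + image + fine-quotient clauses) `length_(p) X = 0` ⟹ `μ = 0`. Rung K6's `X10.mu_eq_zero_of_fine` at `p ∥ N`.
[cite: Kato2004Asterisque, Thm. 12.6 (p. 222), (14.9.3) (p. 240), §17.13 (pp. 279–280)]
[cite: Wuthrich2014, p. 391 and Cor. 18 (p. 398)] [cite: GreenbergLNM1716, §1 Conj. 1.11 (the conclusion's shape)] -/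
theorem mu_eq_zero_of_multFine (hfine : exists_multDivisibilityInputs_fine)
    (h18 : Wuthrich2014.corollary18_padicLFunction_mem_iwasawaAlgebra_multiplicative) :
    ∀ (W : WeierstrassCurve ℚ) [W.IsElliptic] [W.IsGloballyMinimal] (p : ℕ) [Fact p.Prime]
      {N : ℕ} [NeZero N] (f : CuspForm (Gamma0 N) 2),
      p ≠ 2 → W.HasMultiplicativeReductionAtPrime p →
      W.HasIrreducibleModPGaloisRep p → ¬ W.HasSurjectiveModNGaloisRep p → IsNewformOf W f →
      ∀ (ϖ : ℚ), (ϖ : ℝ) * W.realPeriodRat = plusPeriod f →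
      ∀ (a : ℚ_[p]) (L : PowerSeries ℚ_[p]),
        (W.HasSplitMultiplicativeReductionAtPrime p → a = 1) →
        (¬ W.HasSplitMultiplicativeReductionAtPrime p → a = -1) →
        IsMultPAdicLFunctionOf f p a L →
        (∃ n : ℕ, ‖PowerSeries.coeff n (PowerSeries.C ((ϖ : ℚ) : ℚ_[p]) * L)‖ = 1) →
      ∀ (κ : ZpExtension ℚ p) (γ : absoluteGaloisGroup ℚ),
        κ.IsCyclotomic → κ.IsTopGenerator γ → IsCyclotomicVariable p γ →
        ∀ D : W.SelmerDualData κ γ, D.mu = 0 := by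
  intro W _ _ p _ N _ f hp2 hmult hirr hnsurj hf ϖ hϖ a L hsa hna hL hcert κ γ hκ hγ hγ' D
  haveI : ContinuousSMul ℤ_[p] (W.tateModule p) := TateModule.continuousSMul_padicInt
  haveI : Module.Free ℤ_[p] (W.tateModule p) := W.module_free_tateModule_holds p
  haveI : Module.Finite ℤ_[p] (W.tateModule p) := W.module_finite_tateModule_holds p
  -- the pinned modules: `𝐇¹_Γ(T_pW)` and the dual fine Selmer group `X₀(E/ℚ_∞)`
  obtain ⟨I⟩ := nonempty_iwasawaH1Data_holds W p κ γ hκ hγ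
  obtain ⟨Y⟩ := W.nonempty_fineSelmerDualData κ hγ
  haveI : Module.Finite (IwasawaAlgebra p) D.X :=
    WeierstrassCurve.SelmerDualData.module_finite_of_isCyclotomic W κ hκ D hγ
  -- Kato's package at the multiplicative prime, with the fine quotient, the span and the image clauses
  obtain ⟨K, π, hloc0, hπs, hπ, hZ, himg⟩ := hfine W p f κ γ hp2 hmult hκ hγ hγ' hf a L hsa hna hL I D Y
  haveI : Module.Finite (IwasawaAlgebra p) Y.X := Module.Finite.of_surjective π hπs
  -- `ϖ·L ∈ Λ` (Wuthrich 2014 Cor. 18) and the certificate: `G₁ ∉ (p)`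
  obtain ⟨G₁, hG₁⟩ : ∃ G₁ : IwasawaAlgebra p,
      iwasawaToPowerSeries p G₁ = PowerSeries.C ((ϖ : ℚ) : ℚ_[p]) * L := by
    obtain ⟨hns, hs⟩ := h18 W p hp2 hmult hf ϖ hϖ
    by_cases hsplit : W.HasSplitMultiplicativeReductionAtPrime p
    · have ha : a = 1 := hsa hsplit
      subst ha
      exact hs hsplit L ((isMultPAdicLFunctionOf_one_iff L).mp hL)
    · have ha : a = -1 := hna hsplit
      subst ha
      exact hns hsplit L hL
  have hμL : G₁ ∉ IwasawaAlgebra.augIdealP p := not_mem_augIdealP_of_norm_coeff_eq_one hG₁ hcert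
  let 𝔭 : PrimeSpectrum (IwasawaAlgebra p) :=
    ⟨IwasawaAlgebra.augIdealP p, IwasawaAlgebra.isPrime_augIdealP_holds p⟩
  have himg𝔭 : ∃ s : IwasawaAlgebra p, s ∉ IwasawaAlgebra.augIdealP p ∧
      s * G₁ ∈ Submodule.map (K.col ∘ₗ K.loc) K.Z := by
    obtain ⟨s, hs, hsG, -⟩ :=
      himg hirr G₁ ϖ hϖ hG₁ 𝔭 (by exact IwasawaAlgebra.height_augIdealP_holds p)
    exact ⟨s, hs, hsG⟩
  -- §6 (i): some GENUINE Euler-system class is not divisible by `p`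
  obtain ⟨s, hs, hsp⟩ := exists_isEulerSystemClass_not_mem_of_mult K hZ hμL himg𝔭
  -- the reduction-free core: a power of `T` kills the `E[p]`-lifts of `Sel₀`
  obtain ⟨J, hJ⟩ := CoreAssembly.coreOdd_anyReduction_holds W p κ γ I hp2 hirr
    (by exact_mod_cast hnsurj) hκ hγ ⟨s, hs, hsp⟩
  haveI : Finite (Y.X ⧸ (IwasawaAlgebra.augIdealP p • (⊤ : Submodule (IwasawaAlgebra p) Y.X))) :=
    Y.finite_quotient_augIdealP_of_finite_pTorsion
      (W.finite_fineSelmerInfty_pTorsion_of_forall_iterate_eq_zero κ hγ hJ)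
  -- bookkeeping at `𝔭 = (p)`: `length X₀_𝔭 = 0 ⟹ length X_𝔭 = 0 ⟹ μ(X) = 0`
  have hY0 : Module.lengthAt (IwasawaAlgebra p) Y.X 𝔭 = 0 :=
    Summit.BirchSwinnertonDyer.BirchSwinnertonDyer.Rank1Residual.KatoMuSkeleton.lengthAt_eq_zero_of_finite_quotient_p
      (M := Y.X) 𝔭 rfl
  have hX0 : Module.lengthAt (IwasawaAlgebra p) D.X 𝔭 = 0 :=
    le_antisymm ((lengthAt_X_le_of_mult K hloc0 𝔭 hμL himg𝔭 π hπ).trans hY0.le) bot_le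
  change muInvariant p D.X = 0
  rw [muInvariant_eq_toNat_lengthAt p D.X 𝔭 rfl, hX0]
  rfl

end Summit.BirchSwinnertonDyer.Rank1Residual.X11b.MultMu

end
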